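import Summits.QuantumFields.BalabanUV.Beta.EriceRemainderEnclosureHistoryAutonomyComparisonDefectUniformEnclosure

/-!
# EriceRemainderEnclosureHistoryAutonomyComparisonDefectSecondMoment — (E140k) **THE SATURATION CONSTANT IS THE SECOND AGE MOMENT: `1∕h′_j² ≥ 1∕h_j² − θ₂·δ∕(1−θ)`,
# `θ₂ = Σ_k Λ_k·k(k+1)∕2`, UNIFORMLY IN THE DEPTH — and this is the right order.**  (E140g) bounded the level deficit of a sign-free excess (defect `τ`, oscillation `δ`,
# `(1+τ)θ ≤ 1`, `θ < 1`) by `(K−1)·θδ∕(1−θ)`, charging each of the last `K−1` rows of an interval the full per-row cap `F = θδ∕(1−θ)`.  Finer bookkeeping: a negative dual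
# step borrows `X⁻_n ≤ Σ_k Λ_k Σ_{1≤l≤k} X⁺_{n+l} − E_n` (the row's OWN SOURCE is subtracted — (E138b)'s lower link keeps it), an outside positive step is at most
# `E_{n+l} + F ≤ (1+τ)E_n + δ + F`, and the weight of the lags leaving the interval from row `n` is `≤ θ`, so `E_n` pays for the outside SOURCES and only `δ + F` per unit
# weight remains; summing the leaving weights lag by lag (`≤ l+1` rows at lag `l`) gives the SECOND AGE MOMENT `θ₂ = Σ_k Λ_k Σ_{l<k}(l+1)`.  RESULT
# (`level_deficit_le_second`): **`1∕h_j² − θ₂(δ + F) ≤ 1∕h′_j²`**, `θ₂(δ+F) = θ₂δ∕(1−θ)`.  For one age `L` (`Λ_L = M`, `θ = LM`): `θ₂δ = θδ(L+1)∕2` against (E140g)'s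
# `Lθδ∕(1−θ)`; and the hinge-with-switch family REALISES `≈ θδ(L+1)(1−θ)∕2` (numerics `HOME/…/g108/kit/saturationhinge.py`: L = 1…6, e.g. L = 6, θ = 0.12: deficit
# `2.75·F` observed, `(L+1)(1−θ)∕2 = 3.08`, (E140g) allows `6`): the growth with the memory RANGE is real and the second moment is its sharp first-order form.

Cell `pub-balaban`, β-function sub-cell, BINDER row D4 «RemainderConst leaves for Bałaban's split» (`HOME/BINDER-OWNERS.md`; owner lineage `b2b-balaban-beta-an4`;
this file by co-owner #2 lineage `b2b-balaban-beta-d4-p2`, generation 108), β-FLOW TEAM duty (1), FREEZE (0) honoured (def-free; (E140g) `lindley_lower` ∕ `shifted_sum_le` ∕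
`level_rec_lower`, (E140c) `dual_steps_osc` ∕ `flow_source_le_osc`, (E138b) `flow_link_lower`, (E138a) `dual_step_eq_levels`, (E48a) `family_zero`, (E39), (E43b) BY NAME;
nothing restated).

HONEST FRAMING (page 1, verbatim and binding).  *"Discharging BetaPertH makes Bałaban's UV stability UNCONDITIONAL — a real constructive-QFT result; it is
NOT the continuum limit and NOT the Clay problem."*  THIS FILE DISCHARGES NOTHING OF THE KIND.  Elementary real analysis about ABSTRACT functionals on a box
]0,γ]^ℕ (node U2's `MemFlow` ∕ `SeqBox`) — hypotheses of a census, not facts: nothing about Bałaban's (1.22) limit functional (its age profile or second age moment) is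
PRINTED in this form ([I] p. 298; GAPS G-t4-U2-1∕-2) or asserted.  Row D4 class UNCHANGED (critical-path width 0; instance 0∕1; D4 DISCHARGE NO DATE).  NOT B12 Thm 2,
NOT BetaPertH, NOT continuum YM, NOT Clay.

WHAT IS PROVED ([folklore]; 0 `def`, 0 sorry).  §1 (sequences) `inside_le`, `outside_card_le`, **`row_bound`**, **`interval_sum_lower_second`** (the weight
`Σ_{l<k}(l+1)` is `k(k+1)∕2`, Mathlib's Gauss sum; kept in the displayed form).  §2 (flow) `borrow_with_source`, **`level_deficit_le_second`**.
-/

noncomputable section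
open Finset Set

namespace Summit.QuantumFields.BalabanUV.Beta.EriceRemainderEnclosureHistoryAutonomyComparisonDefectSecondMoment

open Literature.MathematicalPhysics.QuantumFieldTheory.Balaban1983to89
open Literature.MathematicalPhysics.QuantumFieldTheory.Balaban1983to89.T4BetaStationary
open Literature.MathematicalPhysics.QuantumFieldTheory.Balaban1983to89.T4BetaFlowWellPosed
open Summit.QuantumFields.BalabanUV.Beta.EriceRemainderEnclosureHistoryAutonomyOrder (family_zero)
open Summit.QuantumFields.BalabanUV.Beta.EriceRemainderEnclosureHistoryAutonomyComparisonDualContractionLinks (dual_step_eq_levels)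
open Summit.QuantumFields.BalabanUV.Beta.EriceRemainderEnclosureHistoryAutonomyComparisonDualContraction (flow_link_lower)
open Summit.QuantumFields.BalabanUV.Beta.EriceRemainderEnclosureHistoryAutonomyComparisonDefectOscillation (dual_steps_osc flow_source_le_osc)
open Summit.QuantumFields.BalabanUV.Beta.EriceRemainderEnclosureHistoryAutonomyComparisonDefectUniform (lindley_lower shifted_sum_le level_rec_lower)

/-! ## §1 Sequences: interval sums of forward-borrowing steps, second-moment form -/

/-- For a fixed lag `l`: the INSIDE part of the borrowed positive steps (those landing inside the interval `[i, i+t)`) is a shifted partial sum of the interval's own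
positive parts, hence at most their total. [folklore] -/
theorem inside_le {X : ℕ → ℝ} (i t l : ℕ) :
    ∑ a ∈ range t, (if a + l + 1 < t then max (X (i + a + (l + 1))) 0 else 0) ≤ ∑ a ∈ range t, max (X (i + a)) 0 := by
  rw [← sum_filter]
  have hset : (range t).filter (fun a => a + l + 1 < t) = range (t - (l + 1)) := by
    ext a; simp only [Finset.mem_filter, Finset.mem_range]; omega
  rw [hset]
  have e : ∑ a ∈ range (t - (l + 1)), max (X (i + a + (l + 1))) 0 = ∑ a ∈ range (t - (l + 1)), max (X (i + (l + 1) + a)) 0 :=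
    sum_congr rfl fun a _ => by rw [show i + a + (l + 1) = i + (l + 1) + a by omega]
  rw [e]
  rcases le_or_gt (l + 1) t with hl | hl
  · have := shifted_sum_le (g := fun c => max (X (i + c)) 0) (fun c => le_max_right _ _) (s := l + 1) (t' := t - (l + 1)) (t := t) (by omega)
    have e2 : ∑ a ∈ range (t - (l + 1)), max (X (i + (l + 1) + a)) 0 = ∑ a ∈ range (t - (l + 1)), max (X (i + (l + 1 + a))) 0 :=
      sum_congr rfl fun a _ => by rw [show i + (l + 1) + a = i + (l + 1 + a) by omega]
    rw [e2]; exact this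
  · rw [show t - (l + 1) = 0 by omega, sum_range_zero]
    exact sum_nonneg fun a _ => le_max_right _ _

/-- For a fixed lag `l`: at most `l + 1` rows of the interval borrow at lag `l` from OUTSIDE the interval (the last `l + 1` rows). [folklore] -/
theorem outside_card_le (t l : ℕ) :
    ∑ a ∈ range t, (if a + l + 1 < t then (0 : ℝ) else 1) ≤ (l : ℝ) + 1 := by
  have e : ∑ a ∈ range t, (if a + l + 1 < t then (0 : ℝ) else 1) = ∑ a ∈ (range t).filter (fun a => ¬ (a + l + 1 < t)), (1 : ℝ) := by
    rw [sum_filter]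
    refine sum_congr rfl fun a _ => ?_
    by_cases h : a + l + 1 < t
    · rw [if_pos h, if_neg (not_not.mpr h)]
    · rw [if_neg h, if_pos h]
  rw [e, sum_const, nsmul_eq_mul, mul_one]
  have hsub : (range t).filter (fun a => ¬ (a + l + 1 < t)) ⊆ Ico (t - (l + 1)) t := by
    intro a ha
    simp only [Finset.mem_filter, Finset.mem_range] at ha
    simp only [Finset.mem_Ico]; omega
  have hcard := Finset.card_le_card hsub
  rw [Nat.card_Ico] at hcard
  have : (((range t).filter (fun a => ¬ (a + l + 1 < t))).card : ℝ) ≤ ((t - (t - (l + 1)) : ℕ) : ℝ) := by exact_mod_cast hcard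
  refine this.trans ?_
  have : t - (t - (l + 1)) ≤ l + 1 := by omega
  exact_mod_cast this

/-- **ONE ROW.**  With the borrowing inequality WITH SOURCE `X⁻_n ≤ (Σ_k Λ_k Σ_{l<k} X⁺_{n+l+1} − E_n)⁺`, the overshoot bound `X_m − E_m ≤ F`, and the source oscillation
`E_{n+l+1} ≤ (1+τ)E_n + δ` (`(1+τ)θ ≤ 1`): the negative part of row `n = i + a` is at most the INSIDE borrowed positive parts plus `ω_a·(δ + F)`, where `ω_a` is the
profile-weighted count of lags that leave the interval — the row's own source `E_n` pays for the sources of the outside steps (`ω_a(1+τ) ≤ θ(1+τ) ≤ 1`). [folklore] -/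
theorem row_bound {X E Λ : ℕ → ℝ} {K : ℕ} {τ δ F : ℝ} (hΛ : ∀ k, 0 ≤ Λ k)
    (hθτ : (1 + τ) * ∑ k ∈ range K, (k : ℝ) * Λ k ≤ 1) (hτ : 0 ≤ τ) (hδ : 0 ≤ δ) (hF : 0 ≤ F)
    (hE0 : ∀ n, 0 ≤ E n) (hEosc : ∀ n l, E (n + (l + 1)) ≤ (1 + τ) * E n + δ)
    (hos : ∀ n, X n - E n ≤ F)
    (hborrow : ∀ n, max (-X n) 0 ≤ max (∑ k ∈ range K, Λ k * ∑ l ∈ range k, max (X (n + (l + 1))) 0 - E n) 0)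
    (i t a : ℕ) :
    max (-X (i + a)) 0 ≤ ∑ k ∈ range K, Λ k * ∑ l ∈ range k, (if a + l + 1 < t then max (X (i + a + (l + 1))) 0 else 0)
      + (∑ k ∈ range K, Λ k * ∑ l ∈ range k, (if a + l + 1 < t then (0 : ℝ) else 1)) * (δ + F) := by
  set n := i + a with hn
  set A : ℝ := ∑ k ∈ range K, Λ k * ∑ l ∈ range k, (if a + l + 1 < t then max (X (i + a + (l + 1))) 0 else 0) with hA
  set ω : ℝ := ∑ k ∈ range K, Λ k * ∑ l ∈ range k, (if a + l + 1 < t then (0 : ℝ) else 1) with hω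
  -- each borrowed positive step: inside part + outside part bounded by (1+τ)E_n + δ + F
  have hsplit : ∀ l, max (X (n + (l + 1))) 0 ≤ (if a + l + 1 < t then max (X (i + a + (l + 1))) 0 else 0)
      + (if a + l + 1 < t then (0 : ℝ) else 1) * ((1 + τ) * E n + δ + F) := by
    intro l
    by_cases h : a + l + 1 < t
    · rw [if_pos h, if_pos h, zero_mul, add_zero, hn]
    · rw [if_neg h, if_neg h, one_mul, zero_add]
      have h1 : X (n + (l + 1)) ≤ E (n + (l + 1)) + F := by linarith [hos (n + (l + 1))]
      have h2 := hEosc n l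
      exact max_le (by linarith) (by nlinarith [hE0 n])
  have hsum : ∑ k ∈ range K, Λ k * ∑ l ∈ range k, max (X (n + (l + 1))) 0 ≤ A + ω * ((1 + τ) * E n + δ + F) := by
    have h1 : ∀ k ∈ range K, Λ k * ∑ l ∈ range k, max (X (n + (l + 1))) 0
        ≤ Λ k * ∑ l ∈ range k, (if a + l + 1 < t then max (X (i + a + (l + 1))) 0 else 0)
          + Λ k * (∑ l ∈ range k, (if a + l + 1 < t then (0 : ℝ) else 1)) * ((1 + τ) * E n + δ + F) := by
      intro k _
      have hs := sum_le_sum fun l (_ : l ∈ range k) => hsplit l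
      rw [sum_add_distrib, ← sum_mul] at hs
      have := mul_le_mul_of_nonneg_left hs (hΛ k)
      rw [mul_add, ← mul_assoc] at this
      exact this
    have h2 := sum_le_sum h1
    rw [sum_add_distrib, ← sum_mul] at h2
    rw [hA, hω]
    exact h2
  -- ω ≤ θ, so ω(1+τ) ≤ 1
  have hωθ : ω ≤ ∑ k ∈ range K, (k : ℝ) * Λ k := by
    rw [hω]
    refine sum_le_sum fun k _ => ?_
    have hc : ∑ l ∈ range k, (if a + l + 1 < t then (0 : ℝ) else 1) ≤ (k : ℝ) := by
      have h1 : ∑ l ∈ range k, (if a + l + 1 < t then (0 : ℝ) else 1) ≤ ∑ l ∈ range k, (1 : ℝ) :=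
        sum_le_sum fun l _ => by split_ifs <;> norm_num
      rwa [sum_const, card_range, nsmul_eq_mul, mul_one] at h1
    nlinarith [hΛ k]
  have hω0 : 0 ≤ ω := sum_nonneg fun k _ => mul_nonneg (hΛ k) (sum_nonneg fun l _ => by split_ifs <;> norm_num)
  have hA0 : 0 ≤ A := sum_nonneg fun k _ => mul_nonneg (hΛ k) (sum_nonneg fun l _ => by split_ifs <;> [exact le_max_right _ _; exact le_rfl])
  have hω1 : ω * (1 + τ) ≤ 1 := by nlinarith
  -- conclude
  refine (hborrow n).trans (max_le ?_ (by positivity))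
  have hEn := hE0 n
  have : ω * ((1 + τ) * E n + δ + F) - E n ≤ ω * (δ + F) := by nlinarith
  linarith

/-- **INTERVAL SUMS, SECOND AGE MOMENT: `Σ_{a<t} X_{i+a} ≥ −θ₂·(δ + F)`**, `θ₂ = Σ_k Λ_k Σ_{l<k}(l+1) = Σ_k Λ_k·k(k+1)∕2` — inside the interval every borrowed positive
step is repaid by the interval's own positive steps (total weight `θ ≤ 1`); what leaves the interval is, lag by lag, at most `l + 1` rows each costing `Λ·(δ + F)` net of
its own source.  Compare (E140g) `interval_sum_lower`: `(K−1)·F`. [folklore] -/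
theorem interval_sum_lower_second {X E Λ : ℕ → ℝ} {K : ℕ} {τ δ F : ℝ} (hΛ : ∀ k, 0 ≤ Λ k)
    (hθ1 : ∑ k ∈ range K, (k : ℝ) * Λ k ≤ 1) (hθτ : (1 + τ) * ∑ k ∈ range K, (k : ℝ) * Λ k ≤ 1) (hτ : 0 ≤ τ) (hδ : 0 ≤ δ) (hF : 0 ≤ F)
    (hE0 : ∀ n, 0 ≤ E n) (hEosc : ∀ n l, E (n + (l + 1)) ≤ (1 + τ) * E n + δ)
    (hos : ∀ n, X n - E n ≤ F)
    (hborrow : ∀ n, max (-X n) 0 ≤ max (∑ k ∈ range K, Λ k * ∑ l ∈ range k, max (X (n + (l + 1))) 0 - E n) 0)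
    (i t : ℕ) :
    -((∑ k ∈ range K, Λ k * ∑ l ∈ range k, ((l : ℝ) + 1)) * (δ + F)) ≤ ∑ a ∈ range t, X (i + a) := by
  set Sp : ℝ := ∑ a ∈ range t, max (X (i + a)) 0 with hSp
  set Sm : ℝ := ∑ a ∈ range t, max (-X (i + a)) 0 with hSm
  set θ₂ : ℝ := ∑ k ∈ range K, Λ k * ∑ l ∈ range k, ((l : ℝ) + 1) with hθ₂
  have hsplit : ∑ a ∈ range t, X (i + a) = Sp - Sm := by
    rw [hSp, hSm, ← sum_sub_distrib]
    exact sum_congr rfl fun a _ => (max_zero_sub_max_neg_zero_eq_self _).symm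
  have hSp0 : 0 ≤ Sp := sum_nonneg fun a _ => le_max_right _ _
  have hδF : 0 ≤ δ + F := by linarith
  rw [hsplit]
  suffices hkey : Sm ≤ Sp + θ₂ * (δ + F) by linarith
  -- sum the row bounds
  have h1 : Sm ≤ ∑ a ∈ range t, (∑ k ∈ range K, Λ k * ∑ l ∈ range k, (if a + l + 1 < t then max (X (i + a + (l + 1))) 0 else 0)
      + (∑ k ∈ range K, Λ k * ∑ l ∈ range k, (if a + l + 1 < t then (0 : ℝ) else 1)) * (δ + F)) :=
    sum_le_sum fun a _ => row_bound hΛ hθτ hτ hδ hF hE0 hEosc hos hborrow i t a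
  rw [sum_add_distrib, ← sum_mul] at h1
  -- inside total ≤ θ·Sp ≤ Sp
  have hin : ∑ a ∈ range t, ∑ k ∈ range K, Λ k * ∑ l ∈ range k, (if a + l + 1 < t then max (X (i + a + (l + 1))) 0 else 0)
      ≤ Sp := by
    rw [sum_comm]
    have h2 : ∀ k ∈ range K, ∑ a ∈ range t, Λ k * ∑ l ∈ range k, (if a + l + 1 < t then max (X (i + a + (l + 1))) 0 else 0)
        ≤ ((k : ℝ) * Λ k) * Sp := by
      intro k _
      rw [← mul_sum, sum_comm]
      have h3 : ∑ l ∈ range k, ∑ a ∈ range t, (if a + l + 1 < t then max (X (i + a + (l + 1))) 0 else 0) ≤ ∑ l ∈ range k, Sp :=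
        sum_le_sum fun l _ => inside_le i t l
      rw [sum_const, card_range, nsmul_eq_mul] at h3
      nlinarith [hΛ k]
    refine (sum_le_sum h2).trans ?_
    rw [← sum_mul]
    nlinarith
  -- outside count total ≤ θ₂
  have hout : ∑ a ∈ range t, ∑ k ∈ range K, Λ k * ∑ l ∈ range k, (if a + l + 1 < t then (0 : ℝ) else 1) ≤ θ₂ := by
    rw [sum_comm, hθ₂]
    refine sum_le_sum fun k _ => ?_
    rw [← mul_sum, sum_comm]
    exact mul_le_mul_of_nonneg_left (sum_le_sum fun l _ => outside_card_le t l) (hΛ k)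
  have hout' := mul_le_mul_of_nonneg_right hout hδF
  linarith


/-! ## §2 The flow: borrowing with the row's own source, and the second-moment deficit bound -/

variable {B B' : (ℕ → ℝ) → ℝ} {M γ b : ℝ} {S : ℝ → ℕ → ℝ} {h h' : ℕ → ℝ}

/-- **BORROWING WITH THE ROW'S OWN SOURCE**: `X⁻_n ≤ (Σ_{k<K} Λ_k Σ_{l<k} X⁺_{n+l+1} − E_n)⁺` — (E138b)'s lower link `E_n − X_n ≤ Σ_k Λ_k Σ_{l≤k} X⁺_{n+l}` with the `l = 0`
terms dead when `X_n < 0` ((E140g) `neg_part_le_window` dropped `E_n`; here it is kept). [folklore] -/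
theorem borrow_with_source {Λ : ℕ → ℝ} {K : ℕ} (hb : 0 < b)
    (hmono : ∀ u v : ℕ → ℝ, SeqBox γ u → SeqBox γ v → (∀ i, u i ≤ v i) → B u ≤ B v)
    (hB : ∀ u u' : ℕ → ℝ, SeqBox γ u → SeqBox γ u' → ∀ D : ℝ, (∀ j, |u j - u' j| ≤ D) → |B u - B u'| ≤ M * D) (hM : 0 ≤ M)
    (hlo : ∀ u, SeqBox γ u → b ≤ B u)
    (hS : ∀ p, 0 < p → p ≤ γ → SeqBox γ (S p) ∧ MemFlow B p (S p))
    (huniq : ∀ p, 0 < p → p ≤ γ → ∀ u u' : ℕ → ℝ, SeqBox γ u → SeqBox γ u' → MemFlow B p u → MemFlow B p u' → u = u')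
    (hΛ : ∀ k, 0 ≤ Λ k)
    (hLip : ∀ u v : ℕ → ℝ, SeqBox γ u → SeqBox γ v → (∀ k : ℕ, 1 / γ ^ 2 + ((k : ℝ) + 1) * b ≤ 1 / u k ^ 2) →
      (∀ k : ℕ, 1 / γ ^ 2 + ((k : ℝ) + 1) * b ≤ 1 / v k ^ 2) → B u - B v ≤ ∑ k ∈ range K, Λ k * max (1 / v k ^ 2 - 1 / u k ^ 2) 0)
    (hexc : ∀ u, SeqBox γ u → B u ≤ B' u)
    (hh' : SeqBox γ h') {y : ℝ} (hy : 0 < y) (hyγ : y ≤ γ) (hf' : MemFlow B' y h') (n : ℕ) :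
    max (-(1 / h' (n + 1) ^ 2 - 1 / S (h' n) 1 ^ 2)) 0
      ≤ max (∑ k ∈ range K, Λ k * ∑ l ∈ range k, max (1 / h' (n + (l + 1) + 1) ^ 2 - 1 / S (h' (n + (l + 1))) 1 ^ 2) 0
          - (B' (fun i => h' (n + 1 + i)) - B (fun i => h' (n + 1 + i)))) 0 := by
  have hlink := flow_link_lower hb hmono hB hM hlo hS huniq hΛ hLip hexc hh' hy hyγ hf' n
  by_cases hX : 0 ≤ 1 / h' (n + 1) ^ 2 - 1 / S (h' n) 1 ^ 2
  · rw [max_eq_right (by linarith)]; exact le_max_right _ _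
  · have hX' : 1 / h' (n + 1) ^ 2 - 1 / S (h' n) 1 ^ 2 < 0 := lt_of_not_ge hX
    rw [max_eq_left (by linarith)]
    have hz : max (1 / h' (n + 0 + 1) ^ 2 - 1 / S (h' (n + 0)) 1 ^ 2) 0 = 0 := by
      simp only [Nat.add_zero]; exact max_eq_right hX'.le
    have hsplit : ∀ k ∈ range K, Λ k * ∑ l ∈ range (k + 1), max (1 / h' (n + l + 1) ^ 2 - 1 / S (h' (n + l)) 1 ^ 2) 0
        = Λ k * ∑ l ∈ range k, max (1 / h' (n + (l + 1) + 1) ^ 2 - 1 / S (h' (n + (l + 1))) 1 ^ 2) 0 := by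
      intro k _
      rw [sum_range_succ', hz, add_zero]
    rw [sum_congr rfl hsplit] at hlink
    refine le_trans ?_ (le_max_left _ _)
    linarith

/-- **THE SATURATION CONSTANT IS THE SECOND AGE MOMENT.**  `B`: isotone on the box `]0,γ]^ℕ`, zeroth moment `M`, floor `b > 0`, LEVEL-LIPSCHITZ IN ITS HISTORY with age profile
`Λ ≥ 0` on `range K` over the graded box, `θ := Σ_{k<K} k·Λ_k < 1`, and SECOND AGE MOMENT `θ₂ := Σ_{k<K} Λ_k·k(k+1)∕2` (written `Σ_k Λ_k Σ_{l<k}(l+1)`).  `B′`: ANY functional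
with `B ≤ B′ ≤ β̄` on the box whose excess `D = B′ − B` satisfies `u ≤ v ⟹ D u ≤ (1+τ)·D v + δ` (`τ, δ ≥ 0`), `(1+τ)θ ≤ 1`.  `h, h′`: ANY box solutions of `B, B′` from one
pin `p`.  Then at EVERY scale `j`:  **`1∕h_j² − θ₂·(δ + θδ∕(1−θ)) ≤ 1∕h′_j²`**  (`= 1∕h_j² − θ₂δ∕(1−θ)`), uniformly in the depth — (E140g) had `(K−1)·θδ∕(1−θ)`; the
hinge-with-switch family at age `L` realises `≈ θδ(L+1)(1−θ)∕2 = θ₂δ(1−θ)`: sharp to first order in `θ`. [folklore] -/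
theorem level_deficit_le_second {Λ : ℕ → ℝ} {K : ℕ} {βb p τ δ : ℝ}
    (hmono : ∀ u v : ℕ → ℝ, SeqBox γ u → SeqBox γ v → (∀ i, u i ≤ v i) → B u ≤ B v)
    (hB : ∀ u u' : ℕ → ℝ, SeqBox γ u → SeqBox γ u' → ∀ D : ℝ, (∀ j, |u j - u' j| ≤ D) → |B u - B u'| ≤ M * D) (hM : 0 ≤ M)
    (hb : 0 < b) (hlo : ∀ u, SeqBox γ u → b ≤ B u)
    (hΛ : ∀ k, 0 ≤ Λ k) (hθ : ∑ k ∈ range K, (k : ℝ) * Λ k < 1)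
    (hτ : 0 ≤ τ) (hθτ : (1 + τ) * ∑ k ∈ range K, (k : ℝ) * Λ k ≤ 1) (hδ : 0 ≤ δ)
    (hLip : ∀ u v : ℕ → ℝ, SeqBox γ u → SeqBox γ v → (∀ k : ℕ, 1 / γ ^ 2 + ((k : ℝ) + 1) * b ≤ 1 / u k ^ 2) →
      (∀ k : ℕ, 1 / γ ^ 2 + ((k : ℝ) + 1) * b ≤ 1 / v k ^ 2) → B u - B v ≤ ∑ k ∈ range K, Λ k * max (1 / v k ^ 2 - 1 / u k ^ 2) 0)
    (hexc : ∀ u, SeqBox γ u → B u ≤ B' u) (hbdd : ∀ u, SeqBox γ u → B' u ≤ βb)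
    (hDosc : ∀ u v : ℕ → ℝ, SeqBox γ u → SeqBox γ v → (∀ i, u i ≤ v i) → B' u - B u ≤ (1 + τ) * (B' v - B v) + δ)
    (hp : 0 < p) (hpγ : p ≤ γ) (hh : SeqBox γ h) (hf : MemFlow B p h) (hh' : SeqBox γ h') (hf' : MemFlow B' p h') (j : ℕ) :
    1 / h j ^ 2 - (∑ k ∈ range K, Λ k * ∑ l ∈ range k, ((l : ℝ) + 1))
        * (δ + (∑ k ∈ range K, (k : ℝ) * Λ k) * δ / (1 - ∑ k ∈ range K, (k : ℝ) * Λ k)) ≤ 1 / h' j ^ 2 := by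
  set F : ℝ := (∑ k ∈ range K, (k : ℝ) * Λ k) * δ / (1 - ∑ k ∈ range K, (k : ℝ) * Λ k) with hFdef
  set θ₂ : ℝ := ∑ k ∈ range K, Λ k * ∑ l ∈ range k, ((l : ℝ) + 1) with hθ₂
  -- the unique base family
  have hex : ∀ q : ℝ, 0 < q → q ≤ γ → ∃ k : ℕ → ℝ, SeqBox γ k ∧ MemFlow B q k :=
    fun q hq hqγ => Summit.QuantumFields.BalabanUV.Beta.EriceRemainderEnclosureHistoryAutonomyExistence.exists_memFlow_zm hB hM hq hqγ hb hlo
  choose! S hSb hSf using hex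
  have hS : ∀ q, 0 < q → q ≤ γ → SeqBox γ (S q) ∧ MemFlow B q (S q) := fun q hq hqγ => ⟨hSb q hq hqγ, hSf q hq hqγ⟩
  have huniq : ∀ q, 0 < q → q ≤ γ → ∀ u u' : ℕ → ℝ, SeqBox γ u → SeqBox γ u' → MemFlow B q u → MemFlow B q u' → u = u' :=
    fun q hq _ u u' hu hu' hfu hfu' =>
      Summit.QuantumFields.BalabanUV.Beta.EriceRemainderEnclosureHistoryAutonomyMonotoneGeneral.memFlow_unique_of_monotone_zm
        hmono hB hM hq hb hlo hu hu' hfu hfu'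
  have e : h = S p := huniq p hp hpγ _ _ hh (hS p hp hpγ).1 hf (hS p hp hpγ).2
  have hθ0 : 0 ≤ ∑ k ∈ range K, (k : ℝ) * Λ k := sum_nonneg fun k _ => mul_nonneg (Nat.cast_nonneg k) (hΛ k)
  have hF0 : 0 ≤ F := div_nonneg (mul_nonneg hθ0 hδ) (by linarith)
  have hlo' : ∀ u, SeqBox γ u → b ≤ B' u := fun u hu => (hlo u hu).trans (hexc u hu)
  -- Lindley with the second-moment interval bound
  have key := lindley_lower (L := fun j => 1 / h' j ^ 2 - 1 / S p j ^ 2) (X := fun m => 1 / h' (m + 1) ^ 2 - 1 / S (h' m) 1 ^ 2)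
    (C := θ₂ * (δ + F))
    (by show 0 ≤ 1 / h' 0 ^ 2 - 1 / S p 0 ^ 2; rw [hf'.1, family_zero hS hp hpγ]; simp)
    (fun j => level_rec_lower hb hmono hB hM hlo hS huniq hh' hp hpγ j)
    (fun i t => interval_sum_lower_second (X := fun m => 1 / h' (m + 1) ^ 2 - 1 / S (h' m) 1 ^ 2)
      (E := fun m => B' (fun i => h' (m + 1 + i)) - B (fun i => h' (m + 1 + i))) hΛ hθ.le hθτ hτ hδ hF0
      (fun m => sub_nonneg.mpr (hexc _ fun i => hh' (m + 1 + i)))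
      (fun m l => flow_source_le_osc hb hlo' hDosc hh' hf' m l)
      (fun n => (dual_steps_osc hb hmono hB hM hlo hS huniq hΛ hθ hτ hθτ hδ hLip hexc hbdd hDosc hh' hp hpγ hf' n).2)
      (fun n => borrow_with_source hb hmono hB hM hlo hS huniq hΛ hLip hexc hh' hp hpγ hf' n) i t) j
  have key' : -(θ₂ * (δ + F)) ≤ 1 / h' j ^ 2 - 1 / S p j ^ 2 := key
  rw [e]
  linarith

end Summit.QuantumFields.BalabanUV.Beta.EriceRemainderEnclosureHistoryAutonomyComparisonDefectSecondMoment

end
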